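import Literature.NumberTheory.EllipticCurves.Rank1Residual.X11RankOneCertificates.Schema
import Literature.NumberTheory.EllipticCurves.PointCountEulerCriterion
import HarnessLib

/-!
# BSD rank-≤1 residual cell: the kernel-evaluable arithmetic of the certificate-record schema is
# CORRECT — `powMod`, `legendreSym` and `countPoints` of `X11RankOneCertificates/Schema.lean` agree
# with `b ^ e % m`, Euler's criterion in `ZMod ℓ`, and `#Ẽ(𝔽_ℓ)` of the reduced integer model

HONEST FRAMING (cell `b2b-bsdres-*`, verbatim): prove what is provable now; shrink each hard class
to its core with data; no claim beyond stated classes; COMBINATION classes deleted from PUBLISHED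
theorems only, CONSTRUCTION-shaped remainder typed; this is not "finishing BSD". Unit
`b2b-bsdres-x11c` (gen 9). Theorems only (no definition, no named fact); a TOOL file.

The record schema (`Schema.lean`, unit x11c gen 0) evaluates inside the kernel (`decide`) with
naive arithmetic: `powMod` (repeated multiplication), `legendreSym a ℓ` (Euler's criterion through
`powMod`), `countPoints [a₁,…,a₆] ℓ = 1 + ∑_{x mod ℓ} (1 + ((a₁x+a₃)² + 4(x³+a₂x²+a₄x+a₆) | ℓ))`.
So far each point count used toward `Irr` (Mazur 1978 Prop. 6.3 (1) via
`IntModel.hasIrreducibleModPGaloisRep_of_intModel_of_noroot`) was a separate kernel theorem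
`card_<label>_<ℓ>` (85 + 58 of them in the window). This file proves the schema's count correct ONCE:

* `powMod_eq` — `powMod b e m = b ^ e % m`;
* `legendreSym_schema_eq` — for an odd prime `ℓ` and `a : ℤ`, the schema's `legendreSym a ℓ` is `0`,
  `1`, `−1` according as `(a : ZMod ℓ) = 0`, `(a : ZMod ℓ)^{ℓ/2} = 1`, or neither (the shape of the
  tree's `card_sol_eq_sum_euler`);
* `natCard_point_eq_countPoints` — for an odd prime `ℓ ∤ Δ(a₁,…,a₆)`:
  `#Ẽ(𝔽_ℓ) = countPoints [a₁,…,a₆] ℓ` for the reduction `(⟨a₁,…,a₆⟩ : WeierstrassCurve ℤ).map (Int.castRingHom (ZMod ℓ))`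
  (`natCard_point_eq_one_add_card` + `card_sol_eq_sum_euler`, re-indexed over `x = 0, …, ℓ−1`).

With it the `Irr` certificate of a record becomes a Bool check of the schema (`CertificateRecordsGeneric.lean`),
and the beyond-window certificate campaign (4 268 X11b pairs, `N < 5·10⁵`) needs no per-record proof text.

References: K. Ireland, M. Rosen, GTM 84 (1990) Prop. 5.1.2 (Euler's criterion), §8.1
[IrelandRosen1990]; J. H. Silverman, *AEC* (2009) V.1 [SilvermanAEC2009].
-/

set_option autoImplicit false

namespace Summit.BirchSwinnertonDyer.Rank1Residual.X11b

open Literature.NumberTheory.EllipticCurves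
  Literature.NumberTheory.EllipticCurves.Rank1Residual.X11RankOneCertificates
open Finset

/-! ### §1. `powMod` -/

/-- `powMod b e m = b ^ e % m` (the schema's repeated-multiplication power). [folklore] -/
theorem powMod_eq (b e m : ℕ) : powMod b e m = b ^ e % m := by
  unfold powMod
  induction e with
  | zero => simp
  | succ e ih =>
    rw [List.range_succ, List.foldl_append, List.foldl_cons, List.foldl_nil, ih, pow_succ,
      Nat.mul_mod, Nat.mod_mod, ← Nat.mul_mod]

/-! ### §2. The schema's Legendre symbol is Euler's criterion in `ZMod ℓ` -/

/-- For an odd prime `ℓ` and `a : ℤ`: the schema's `legendreSym a ℓ` equals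
`if (a : ZMod ℓ) = 0 then 0 else if (a : ZMod ℓ) ^ (ℓ / 2) = 1 then 1 else -1`.
[cite: IrelandRosen1990, Prop. 5.1.2 (Euler's criterion)] -/
theorem legendreSym_schema_eq (a : ℤ) (ℓ : ℕ) [hℓ : Fact ℓ.Prime] (hℓ2 : ℓ ≠ 2) :
    legendreSym a ℓ =
      if (a : ZMod ℓ) = 0 then 0 else if (a : ZMod ℓ) ^ (ℓ / 2) = 1 then 1 else -1 := by
  have hℓpos : 0 < ℓ := hℓ.out.pos
  have hℓ1 : 1 < ℓ := hℓ.out.one_lt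
  have hodd : ℓ % 2 = 1 := Nat.odd_iff.mp (hℓ.out.odd_of_ne_two hℓ2)
  have hk : (ℓ - 1) / 2 = ℓ / 2 := by omega
  set r : ℕ := (a % (ℓ : ℤ)).toNat with hr
  have hmod : 0 ≤ a % (ℓ : ℤ) := Int.emod_nonneg _ (by exact_mod_cast hℓpos.ne')
  have hrZ : (r : ℤ) = a % (ℓ : ℤ) := by rw [hr, Int.toNat_of_nonneg hmod]
  have hra : (r : ZMod ℓ) = (a : ZMod ℓ) := by
    have : ((r : ℤ) : ZMod ℓ) = (a : ZMod ℓ) := by rw [hrZ, ZMod.intCast_mod]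
    exact_mod_cast this
  -- `r = 0 ↔ a ≡ 0`
  have h0 : r = 0 ↔ (a : ZMod ℓ) = 0 := by
    rw [ZMod.intCast_zmod_eq_zero_iff_dvd, Int.dvd_iff_emod_eq_zero, ← hrZ]
    exact ⟨fun h => by simp [h], fun h => by exact_mod_cast h⟩
  -- `r^k % ℓ = 1 ↔ a^k = 1 in ZMod ℓ`
  have h1 : powMod r ((ℓ - 1) / 2) ℓ = 1 ↔ (a : ZMod ℓ) ^ (ℓ / 2) = 1 := by
    rw [powMod_eq, hk, ← hra]
    constructor
    · intro h
      have : (((r ^ (ℓ / 2) % ℓ : ℕ)) : ZMod ℓ) = ((1 : ℕ) : ZMod ℓ) := by rw [h]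
      rwa [ZMod.natCast_mod, Nat.cast_pow, Nat.cast_one] at this
    · intro h
      have : (((r ^ (ℓ / 2) % ℓ : ℕ)) : ZMod ℓ) = ((1 : ℕ) : ZMod ℓ) := by
        rw [ZMod.natCast_mod, Nat.cast_pow, Nat.cast_one, h]
      rw [ZMod.natCast_eq_natCast_iff', Nat.mod_mod, Nat.mod_eq_of_lt hℓ1] at this
      exact this
  show (if r = 0 then (0 : ℤ) else if powMod r ((ℓ - 1) / 2) ℓ = 1 then 1 else -1) = _
  by_cases hz : (a : ZMod ℓ) = 0
  · rw [if_pos (h0.mpr hz), if_pos hz]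
  · rw [if_neg (fun h => hz (h0.mp h)), if_neg hz]
    by_cases hsq : (a : ZMod ℓ) ^ (ℓ / 2) = 1
    · rw [if_pos (h1.mpr hsq), if_pos hsq]
    · rw [if_neg (fun h => hsq (h1.mp h)), if_neg hsq]

/-! ### §3. The schema's point count is `#Ẽ(𝔽_ℓ)` -/

/-- `∑ x : ZMod ℓ, f x = ((List.range ℓ).map (f ∘ Nat.cast)).sum` for `ℓ ≠ 0`. [folklore] -/
theorem sum_zmod_eq_sum_range {M : Type*} [AddCommMonoid M] (ℓ : ℕ) [NeZero ℓ] (f : ZMod ℓ → M) :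
    ∑ x : ZMod ℓ, f x = ((List.range ℓ).map fun i : ℕ => f (i : ZMod ℓ)).sum := by
  rw [← List.sum_toFinset _ List.nodup_range, List.toFinset_range]
  obtain ⟨k, rfl⟩ : ∃ k, ℓ = k + 1 := ⟨ℓ - 1, (Nat.succ_pred_eq_of_pos (NeZero.pos ℓ)).symm⟩
  rw [← Fin.sum_univ_eq_sum_range (fun i => f (i : ZMod (k + 1)))]
  refine Fintype.sum_equiv (Equiv.refl _) _ _ fun x => ?_
  change f x = f ((x : Fin (k + 1)).val : ZMod (k + 1))
  congr 1
  exact (ZMod.natCast_zmod_val x).symm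

/-- **The schema's naive point count is the number of points of the reduction.** For an odd prime
`ℓ` not dividing `Δ(a₁,…,a₆)`: `#Ẽ(𝔽_ℓ)` of `(⟨a₁,…,a₆⟩ : WeierstrassCurve ℤ).map (Int.castRingHom (ZMod ℓ))`
(all affine points plus `O`) equals `countPoints [a₁,…,a₆] ℓ = 1 + ∑_{x < ℓ} (1 + (D(x) | ℓ))`,
`D(x) = (a₁x + a₃)² + 4(x³ + a₂x² + a₄x + a₆)` — `natCard_point_eq_one_add_card` and
`card_sol_eq_sum_euler` (completing the square, Euler's criterion), re-indexed over `x = 0,…,ℓ−1`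
with `legendreSym_schema_eq`. [cite: IrelandRosen1990, Prop. 5.1.2 and §8.1] -/
theorem natCard_point_eq_countPoints (a1 a2 a3 a4 a6 : ℤ) (ℓ : ℕ) [hℓ : Fact ℓ.Prime] (hℓ2 : ℓ ≠ 2)
    (hΔ : ¬ (ℓ : ℤ) ∣ (⟨a1, a2, a3, a4, a6⟩ : WeierstrassCurve ℤ).Δ) :
    (Nat.card (((⟨a1, a2, a3, a4, a6⟩ : WeierstrassCurve ℤ).map
        (Int.castRingHom (ZMod ℓ))).toAffine.Point) : ℤ) = countPoints [a1, a2, a3, a4, a6] ℓ := by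
  set W : WeierstrassCurve (ZMod ℓ) :=
    (⟨a1, a2, a3, a4, a6⟩ : WeierstrassCurve ℤ).map (Int.castRingHom (ZMod ℓ)) with hW
  have hWΔ : W.Δ ≠ 0 := by
    rw [hW, WeierstrassCurve.map_Δ]
    intro h
    exact hΔ ((ZMod.intCast_zmod_eq_zero_iff_dvd _ _).mp (by simpa using h))
  have hchar : ringChar (ZMod ℓ) ≠ 2 := by rw [ZMod.ringChar_zmod_n]; exact hℓ2
  have hcard : Fintype.card (ZMod ℓ) / 2 = ℓ / 2 := by rw [ZMod.card]
  rw [WeierstrassCurve.natCard_point_eq_one_add_card W hWΔ, card_sol_eq_sum_euler hchar W, hcard]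
  simp only [countPoints]
  push_cast
  rw [sum_zmod_eq_sum_range]
  congr 1
  refine congrArg List.sum (List.map_congr_left fun x hx => ?_)
  rw [legendreSym_schema_eq _ ℓ hℓ2]
  have hD : (((a1 * (x : ℤ) + a3) * (a1 * x + a3) + 4 * ((x : ℤ) * x * x + a2 * x * x + a4 * x + a6) : ℤ) :
      ZMod ℓ) = (W.a₁ * (x : ZMod ℓ) + W.a₃) ^ 2 + 4 * ((x : ZMod ℓ) ^ 3 + W.a₂ * (x : ZMod ℓ) ^ 2 +
        W.a₄ * (x : ZMod ℓ) + W.a₆) := by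
    simp only [hW, WeierstrassCurve.map_a₁, WeierstrassCurve.map_a₂, WeierstrassCurve.map_a₃,
      WeierstrassCurve.map_a₄, WeierstrassCurve.map_a₆, eq_intCast]
    push_cast
    ring
  rw [hD]
  split_ifs <;> simp

end Summit.BirchSwinnertonDyer.Rank1Residual.X11b
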